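import Summits.Ventures.HSemireg.WedgeHankelOuterImage
import Summits.Ventures.HSemireg.WedgeHankelPairGrading
import Summits.Ventures.HSemireg.WedgeHankelPairMixingProjection

/-!
# Venture HSemireg — THE PURE PIECES OF TH-7's KERNEL: for every set `A` of pairs, the forms with EXACTLY ONE LETTER FROM EACH PAIR OF `A` (pair type `𝟙_A`) span a
# `2^{|A|}`-dimensional space, and **`dim (Kr(univ, w_N q, |A|) ⊓ Sp(ptype = 𝟙_A)) = 2^{|A|} − rank H_{|A|}(q)`** — every field, every `q`, uniform in `n`; the other
# `C(2|A|, |A|) − 2^{|A|}` degree-`|A|` monomials on the letters of `A` contain a full pair and die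

HONEST FRAMING. Part of the Lean index of the computation cell `pub-hsemireg` (seat p10 gen 23, Sunday typer «UNIFORM-IN-n»).
Finite-dimensional EXTERIOR ALGEBRA over a field ONLY: no variety, no cohomology theory, no sheaf, no Ext group, no semiregularity map;
nothing here says that HC / HC_CM / HC_AV holds; no Literature fact is declared or used.  Custodian versions as in `WedgeHankelSiegelIdeal` (1/3); the dictionary (`w_N(q)` = the
class of the box on `N` pairs; pair type `𝟙_A` = multidegree one in each factor of `A`, zero elsewhere; `H_k(q)` = the `k`-th Hankel matrix) is QUOTED, never asserted.

WHAT IS IN THE TREE.  H10 `WedgeHankelPairGrading` (this lineage, gen 18): the pair type `ptype`, `proj_ptype_mem_Kr_w` (kernels are pair-graded), `w_mem_Sp_Tr`; w3's support calculus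
(`Sp`, `proj`, `proj_mem`, `proj_mem_and`, `proj_add_proj_not`, `Sp_inf_Sp_eq_bot`, `B_mul_eq_zero_of_mem_Sp`, `finrank_Sp`); K40 `finrank_Kr_w_inf_Sp_pairs_add`; L1 (this seat,
`WedgeHankelOuterImage`): `Hom_univ_inf_Sp_pairs_eq`, `card_letters_eq`; K39 `finrank_Hom_In`.
THIS FILE (namespace `Summit.Ventures.HSemireg.Wedge.HankelOuter` continued; imports L1 and H10):
* §373 PURE SUPPORTS: `card_eq_sum_ptype` (`|s| = Σ_c ptype s c`), `ptype_pos_of_mem`, `mem_pairs_of_ptype_eq_indicator` / `card_eq_of_ptype_eq_indicator` (a support of pair type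
  `𝟙_A` has its letters in the pairs of `A` and has `|A|` letters), `Sp_pure_le` (`Sp(ptype = 𝟙_A) ≤ Hom(univ, |A|) ⊓ Sp(pairs ⊆ A)`).
* §374 THE NON-PURE MONOMIALS DIE: `exists_pair_subset_of_not_pure` (a degree-`|A|` support on the letters of `A` that is not pure contains a full pair `{x_c, y_c}`),
  `B_mul_eq_zero_of_pair_subset` (such a monomial kills every transversal class), **`Sp_nonpure_le_Kr`**.
* §375 THE SPLIT: `finrank_inf_Sp_add_finrank_inf_Sp_not` (a subspace closed under `proj_P` splits as `(W ⊓ Sp P) ⊕ (W ⊓ Sp ¬P)`, any predicate `P`, any generator type),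
  and **`finrank_Kr_w_inf_Sp_pure_add_rank`: `dim (Kr(univ, w_N q, |A|) ⊓ Sp(ptype = 𝟙_A)) + rank (hankel1 K N |A| q) = dim Sp(ptype = 𝟙_A)`** (count-free form).
* §376 THE COUNT `finrank_Sp_pure`: `dim Sp(ptype = 𝟙_A) = 2^{|A|}` (the pure supports on `A` are the `x`/`y`-choices `S ⊆ A`), hence **`finrank_Kr_w_inf_Sp_pure_add`:
  `dim (Kr ⊓ Sp(ptype = 𝟙_A)) + rank H_{|A|}(q) = 2^{|A|}`**, `finrank_Kr_w_inf_Sp_pure_eq` (subtraction form) and `finrank_nonpure_eq` (the non-pure degree-`|A|` forms on the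
  letters of `A`: `C(2|A|, |A|) − 2^{|A|}`, all inside the kernel).
READING: by K40 the kernel on the `|A|`-forms of the letters of `A` has dimension `C(2|A|,|A|) − r_{|A|}(q)`; all of the Hankel rank is carried by the `2^{|A|}` PURE monomials, the
non-pure ones being trivially dead.  With H10 (`Kr = ⨁_τ Kr ⊓ Sp(ptype = τ)`) this is the value of every multilinear pair-type piece.  Nothing Ext-side.  New names only.
-/

open Module

namespace Summit.Ventures.HSemireg.Wedge.HankelOuter

open Summit.Ventures.HSemireg.Wedge Summit.Ventures.HSemireg.Wedge.Kunneth Summit.Ventures.HSemireg.Wedge.Hankel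
  Summit.Ventures.HSemireg.Wedge.BasisFree Summit.Ventures.HSemireg.Wedge.HankelSiegel Summit.Ventures.HSemireg.Wedge.HankelSiegelIdeal
  Summit.Ventures.HSemireg.Wedge.KunnethKernel Summit.Ventures.HSemireg.Wedge.HankelFrameChange Summit.Ventures.HSemireg.Wedge.Weil
  Summit.Ventures.HSemireg.Wedge.HankelPairMixing Summit.Ventures.HSemireg.Wedge.HankelPairGrading

variable (K : Type*) [Field K] {N : ℕ}

/-! ## §373. Pure supports -/

omit [Field K] in
/-- `|s| = Σ_c ptype s c`: a support is the disjoint union of its intersections with the pairs. -/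
theorem card_eq_sum_ptype (s : Finset (In N)) : s.card = ∑ c : Fin N, ptype s c :=
  Finset.card_eq_sum_card_fiberwise fun i _ => Finset.mem_coe.mpr (Finset.mem_univ (pr i))

omit [Field K] in
/-- a letter of `s` makes the pair type of its pair positive. -/
theorem ptype_pos_of_mem {s : Finset (In N)} {i : In N} (hi : i ∈ s) : 0 < ptype s (pr i) :=
  Finset.card_pos.mpr ⟨i, Finset.mem_filter.mpr ⟨hi, rfl⟩⟩

omit [Field K] in
/-- `ptype s c ≤ 1` unless both letters of the pair `c` lie in `s`. -/
theorem ptype_le_one_of_not_pair_subset {s : Finset (In N)} {c : Fin N} (h : ¬ (xJ N c ∈ s ∧ yJ N c ∈ s)) : ptype s c ≤ 1 := by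
  rw [ptype, Finset.card_le_one]
  intro a ha b hb
  rw [Finset.mem_filter] at ha hb
  rcases eq_xJ_or_eq_yJ a with ea | ea <;> rcases eq_xJ_or_eq_yJ b with eb | eb <;> rw [ha.2] at ea <;> rw [hb.2] at eb
  · rw [ea, eb]
  · exact absurd ⟨ea ▸ ha.1, eb ▸ hb.1⟩ h
  · exact absurd ⟨eb ▸ hb.1, ea ▸ ha.1⟩ h
  · rw [ea, eb]

omit [Field K] in
/-- a support of pair type `𝟙_A` has all its letters in the pairs of `A`. -/
theorem mem_pairs_of_ptype_eq_indicator {A : Finset (Fin N)} {s : Finset (In N)} (h : ptype s = fun c => if c ∈ A then 1 else 0) :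
    ∀ i ∈ s, pr i ∈ A := by
  intro i hi
  by_contra hc
  have h1 := ptype_pos_of_mem hi
  rw [h] at h1
  dsimp only at h1
  rw [if_neg hc] at h1
  exact lt_irrefl 0 h1

omit [Field K] in
/-- a support of pair type `𝟙_A` has `|A|` letters. -/
theorem card_eq_of_ptype_eq_indicator {A : Finset (Fin N)} {s : Finset (In N)} (h : ptype s = fun c => if c ∈ A then 1 else 0) : s.card = A.card := by
  rw [card_eq_sum_ptype, h, Finset.sum_boole, Nat.cast_id]
  congr 1
  ext c
  simp

/-- **`Sp(ptype = 𝟙_A) ≤ Hom(univ, |A|) ⊓ Sp(pairs ⊆ A)`**: the pure forms on `A` are `|A|`-forms on the letters of `A`. -/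
theorem Sp_pure_le (A : Finset (Fin N)) :
    Sp K (fun s : Finset (In N) => ptype s = fun c => if c ∈ A then 1 else 0)
      ≤ Hom K (In N) Finset.univ A.card ⊓ Sp K (fun s : Finset (In N) => ∀ i ∈ s, pr i ∈ A) := by
  rw [Hom_eq_Sp]
  exact le_inf (Sp_mono fun s hs => ⟨Finset.subset_univ _, card_eq_of_ptype_eq_indicator hs⟩) (Sp_mono fun s hs => mem_pairs_of_ptype_eq_indicator hs)

/-! ## §374. The non-pure monomials on the letters of `A` die -/

omit [Field K] in
/-- **a degree-`|A|` support on the letters of `A` that is NOT pure contains a full pair `{x_c, y_c}`** (otherwise `ptype s ≤ 𝟙_A` pointwise with equal sums `|s| = |A|`). -/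
theorem exists_pair_subset_of_not_pure {A : Finset (Fin N)} {s : Finset (In N)} (hs : ∀ i ∈ s, pr i ∈ A) (hc : s.card = A.card)
    (hne : ¬ ptype s = fun c => if c ∈ A then 1 else 0) : ∃ c : Fin N, xJ N c ∈ s ∧ yJ N c ∈ s := by
  by_contra hno
  rw [not_exists] at hno
  apply hne
  have hle : ∀ c ∈ (Finset.univ : Finset (Fin N)), ptype s c ≤ if c ∈ A then 1 else 0 := by
    intro c _
    split_ifs with hcA
    · exact ptype_le_one_of_not_pair_subset (hno c)
    · rw [Nat.le_zero, ptype, Finset.card_eq_zero, Finset.filter_eq_empty_iff]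
      intro i hi hic
      exact hcA (hic ▸ hs i hi)
  have hsum : ∑ c : Fin N, ptype s c = ∑ c : Fin N, (if c ∈ A then 1 else 0) := by
    rw [← card_eq_sum_ptype, hc, Finset.sum_boole, Nat.cast_id]
    congr 1
    ext c
    simp
  funext c
  exact (Finset.sum_eq_sum_iff_of_le hle).mp hsum c (Finset.mem_univ c)

/-- **a monomial containing a full pair kills every transversal class** (every transversal support meets `{x_c, y_c}`). -/
theorem B_mul_eq_zero_of_pair_subset {s : Finset (In N)} {c : Fin N} (hx : xJ N c ∈ s) (hy : yJ N c ∈ s) {f : HT K (In N)} (hf : f ∈ Sp K (Tr (N := N))) :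
    B K (In N) s * f = 0 := by
  refine B_mul_eq_zero_of_mem_Sp (fun t ht hd => ?_) hf
  by_cases hxt : xJ N c ∈ t
  · exact Finset.disjoint_left.mp hd hx hxt
  · have hyt : yJ N c ∈ t := by
      have h := ht (xJ N c)
      rw [pt_xJ] at h
      by_contra hyt
      exact hxt (h.mpr hyt)
    exact Finset.disjoint_left.mp hd hy hyt

/-- **THE NON-PURE `|A|`-FORMS ON THE LETTERS OF `A` DIE: `Sp(|s| = |A| ∧ pairs ⊆ A ∧ ptype s ≠ 𝟙_A) ≤ Kr(univ, f, |A|)`** for every transversal class `f` (in particular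
`w_N(q)`). -/
theorem Sp_nonpure_le_Kr (A : Finset (Fin N)) {f : HT K (In N)} (hf : f ∈ Sp K (Tr (N := N))) :
    Sp K (fun s : Finset (In N) => (s.card = A.card ∧ ∀ i ∈ s, pr i ∈ A) ∧ ¬ ptype s = fun c => if c ∈ A then 1 else 0)
      ≤ Kr K (Finset.univ : Finset (In N)) f A.card := by
  rw [Sp, Submodule.span_le]
  rintro _ ⟨s, ⟨⟨hc, hs⟩, hne⟩, rfl⟩
  obtain ⟨c, hx, hy⟩ := exists_pair_subset_of_not_pure hs hc hne
  exact mem_Kr.mpr ⟨B_mem_Hom K (Finset.subset_univ _) hc, B_mul_eq_zero_of_pair_subset K hx hy hf⟩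

/-! ## §375. The split of a `proj`-closed subspace; the count-free value -/

section Split

variable {I : Type*} [LinearOrder I] [Fintype I]

/-- **a subspace closed under the coordinate projection `proj_P` splits: `dim (W ⊓ Sp P) + dim (W ⊓ Sp ¬P) = dim W`** (any predicate `P` on supports; the dimension form of
J-leaf `WedgeHankelPairMixingProjection`'s `eq_inf_Sp_sup_inf_Sp_not` / `inf_Sp_disjoint_inf_Sp_not`). -/
theorem finrank_inf_Sp_add_finrank_inf_Sp_not (P : Finset I → Prop) [DecidablePred P] {W : Submodule K (HT K I)}
    (hW : ∀ θ ∈ W, proj (K := K) P θ ∈ W) :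
    finrank K ↥(W ⊓ Sp K P) + finrank K ↥(W ⊓ Sp K (fun s => ¬ P s)) = finrank K ↥W := by
  have h := Submodule.finrank_sup_add_finrank_inf_eq (W ⊓ Sp K P) (W ⊓ Sp K (fun s => ¬ P s))
  rw [← HankelPairMixing.eq_inf_Sp_sup_inf_Sp_not K P hW, (HankelPairMixing.inf_Sp_disjoint_inf_Sp_not K P W).eq_bot, finrank_bot, add_zero] at h
  exact h.symm

end Split

/-- the restricted kernel `Kr(univ, w_N q, k) ⊓ Sp(pairs ⊆ A)` is closed under every pair-type projection. -/
theorem proj_ptype_mem_Kr_w_inf_Sp_pairs (τ : Fin N → ℕ) (A : Finset (Fin N)) (q : ℕ → K) (k : ℕ) {θ : HT K (In N)}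
    (hθ : θ ∈ Kr K (Finset.univ : Finset (In N)) (w K N N q) k ⊓ Sp K (fun s : Finset (In N) => ∀ i ∈ s, pr i ∈ A)) :
    proj (K := K) (fun s : Finset (In N) => ptype s = τ) θ
      ∈ Kr K (Finset.univ : Finset (In N)) (w K N N q) k ⊓ Sp K (fun s : Finset (In N) => ∀ i ∈ s, pr i ∈ A) := by
  classical
  exact ⟨proj_ptype_mem_Kr_w K τ q hθ.1, Sp_mono (fun s hs => hs.1) (proj_mem_and hθ.2)⟩

/-- the `|A|`-forms on the letters of `A` are closed under every pair-type projection. -/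
theorem proj_ptype_mem_Hom_inf_Sp_pairs (τ : Fin N → ℕ) (A : Finset (Fin N)) (k : ℕ) {θ : HT K (In N)}
    (hθ : θ ∈ Hom K (In N) (Finset.univ : Finset (In N)) k ⊓ Sp K (fun s : Finset (In N) => ∀ i ∈ s, pr i ∈ A)) :
    proj (K := K) (fun s : Finset (In N) => ptype s = τ) θ
      ∈ Hom K (In N) (Finset.univ : Finset (In N)) k ⊓ Sp K (fun s : Finset (In N) => ∀ i ∈ s, pr i ∈ A) := by
  classical
  exact ⟨proj_mem_Hom K _ hθ.1, Sp_mono (fun s hs => hs.1) (proj_mem_and hθ.2)⟩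

/-- the pure piece of the restricted kernel is the pure piece of the kernel: `Kr ⊓ Sp(pairs ⊆ A) ⊓ Sp(ptype = 𝟙_A) = Kr ⊓ Sp(ptype = 𝟙_A)`. -/
theorem Kr_inf_Sp_pairs_inf_Sp_pure (A : Finset (Fin N)) (f : HT K (In N)) (k : ℕ) :
    Kr K (Finset.univ : Finset (In N)) f k ⊓ Sp K (fun s : Finset (In N) => ∀ i ∈ s, pr i ∈ A) ⊓ Sp K (fun s : Finset (In N) => ptype s = fun c => if c ∈ A then 1 else 0)
      = Kr K (Finset.univ : Finset (In N)) f k ⊓ Sp K (fun s : Finset (In N) => ptype s = fun c => if c ∈ A then 1 else 0) := by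
  rw [inf_assoc]
  congr 1
  exact inf_eq_right.mpr (Sp_mono fun s hs => mem_pairs_of_ptype_eq_indicator hs)

/-- the pure piece of the `|A|`-forms on the letters of `A` is all of `Sp(ptype = 𝟙_A)`. -/
theorem Hom_inf_Sp_pairs_inf_Sp_pure (A : Finset (Fin N)) :
    Hom K (In N) (Finset.univ : Finset (In N)) A.card ⊓ Sp K (fun s : Finset (In N) => ∀ i ∈ s, pr i ∈ A)
        ⊓ Sp K (fun s : Finset (In N) => ptype s = fun c => if c ∈ A then 1 else 0)
      = Sp K (fun s : Finset (In N) => ptype s = fun c => if c ∈ A then 1 else 0) :=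
  inf_eq_right.mpr (Sp_pure_le K A)

/-- the non-pure piece of the restricted kernel in degree `|A|` is the whole non-pure piece of the `|A|`-forms on the letters of `A` (they all die). -/
theorem Kr_inf_Sp_pairs_inf_Sp_nonpure (A : Finset (Fin N)) {f : HT K (In N)} (hf : f ∈ Sp K (Tr (N := N))) :
    Kr K (Finset.univ : Finset (In N)) f A.card ⊓ Sp K (fun s : Finset (In N) => ∀ i ∈ s, pr i ∈ A)
        ⊓ Sp K (fun s : Finset (In N) => ¬ ptype s = fun c => if c ∈ A then 1 else 0)
      = Hom K (In N) (Finset.univ : Finset (In N)) A.card ⊓ Sp K (fun s : Finset (In N) => ∀ i ∈ s, pr i ∈ A)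
        ⊓ Sp K (fun s : Finset (In N) => ¬ ptype s = fun c => if c ∈ A then 1 else 0) := by
  refine le_antisymm (inf_le_inf (inf_le_inf (Kr_le_Hom K _ f _) le_rfl) le_rfl) ?_
  have hSp : Hom K (In N) (Finset.univ : Finset (In N)) A.card ⊓ Sp K (fun s : Finset (In N) => ∀ i ∈ s, pr i ∈ A)
      ⊓ Sp K (fun s : Finset (In N) => ¬ ptype s = fun c => if c ∈ A then 1 else 0)
      = Sp K (fun s : Finset (In N) => (s.card = A.card ∧ ∀ i ∈ s, pr i ∈ A) ∧ ¬ ptype s = fun c => if c ∈ A then 1 else 0) := by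
    rw [Hom_eq_Sp, Sp_inf_Sp, Sp_inf_Sp]
    apply Sp_congr_iff
    intro s
    exact ⟨fun h => ⟨⟨h.1.1.2, h.1.2⟩, h.2⟩, fun h => ⟨⟨⟨Finset.subset_univ _, h.1.1⟩, h.1.2⟩, h.2⟩⟩
  refine le_inf (le_inf ?_ (le_trans inf_le_left inf_le_right)) inf_le_right
  rw [hSp]
  exact Sp_nonpure_le_Kr K A hf

/-- **THE COUNT-FREE VALUE: `dim (Kr(univ, w_N q, |A|) ⊓ Sp(ptype = 𝟙_A)) + rank (hankel1 K N |A| q) = dim Sp(ptype = 𝟙_A)`** — all of K40's codimension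
`C(|A|,|A|) · r_{|A|}(q) = r_{|A|}(q)` on the `|A|`-forms of the letters of `A` is carried by the pure piece (every `A`, `q`, field). -/
theorem finrank_Kr_w_inf_Sp_pure_add_rank (A : Finset (Fin N)) (q : ℕ → K) :
    finrank K ↥(Kr K (Finset.univ : Finset (In N)) (w K N N q) A.card ⊓ Sp K (fun s : Finset (In N) => ptype s = fun c => if c ∈ A then 1 else 0))
      + (hankel1 K N A.card q).rank
      = finrank K ↥(Sp K (fun s : Finset (In N) => ptype s = fun c => if c ∈ A then 1 else 0)) := by
  classical
  -- split the restricted kernel and the restricted forms along `ptype = 𝟙_A`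
  have h1 := finrank_inf_Sp_add_finrank_inf_Sp_not K (fun s : Finset (In N) => ptype s = fun c => if c ∈ A then 1 else 0)
    (W := Kr K (Finset.univ : Finset (In N)) (w K N N q) A.card ⊓ Sp K (fun s : Finset (In N) => ∀ i ∈ s, pr i ∈ A))
    (fun θ hθ => proj_ptype_mem_Kr_w_inf_Sp_pairs K _ A q A.card hθ)
  have h2 := finrank_inf_Sp_add_finrank_inf_Sp_not K (fun s : Finset (In N) => ptype s = fun c => if c ∈ A then 1 else 0)
    (W := Hom K (In N) (Finset.univ : Finset (In N)) A.card ⊓ Sp K (fun s : Finset (In N) => ∀ i ∈ s, pr i ∈ A))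
    (fun θ hθ => proj_ptype_mem_Hom_inf_Sp_pairs K _ A A.card hθ)
  rw [Kr_inf_Sp_pairs_inf_Sp_pure, Kr_inf_Sp_pairs_inf_Sp_nonpure K A (w_mem_Sp_Tr K q)] at h1
  rw [Hom_inf_Sp_pairs_inf_Sp_pure, Hom_univ_inf_Sp_pairs_eq, finrank_Hom_In, card_letters_eq] at h2
  rw [Hom_univ_inf_Sp_pairs_eq] at h1
  have h3 := finrank_Kr_w_inf_Sp_pairs_add K A A.card q
  rw [Nat.choose_self, one_mul] at h3
  omega

/-! ## §376. The count `dim Sp(ptype = 𝟙_A) = 2^{|A|}` and the value -/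

omit [Field K] in
/-- the pair type of a set of `x`-letters. -/
theorem ptype_image_xJ (S : Finset (Fin N)) : ptype (S.image (xJ N)) = fun c => if c ∈ S then 1 else 0 := by
  classical
  funext c
  rw [ptype, Finset.filter_image, Finset.card_image_of_injective _ xJ_injective]
  simp only [pr_xJ]
  rw [Finset.filter_eq' S c]
  split_ifs <;> simp

omit [Field K] in
/-- the pair type of a set of `y`-letters. -/
theorem ptype_image_yJ (S : Finset (Fin N)) : ptype (S.image (yJ N)) = fun c => if c ∈ S then 1 else 0 := by
  classical
  funext c
  rw [ptype, Finset.filter_image, Finset.card_image_of_injective _ yJ_injective]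
  simp only [pr_yJ]
  rw [Finset.filter_eq' S c]
  split_ifs <;> simp

omit [Field K] in
/-- `x`-letters and `y`-letters are disjoint. -/
theorem disjoint_image_xJ_image_yJ (S S' : Finset (Fin N)) : Disjoint (S.image (xJ N)) (S'.image (yJ N)) := by
  rw [Finset.disjoint_left]
  intro i h1 h2
  obtain ⟨c, -, rfl⟩ := Finset.mem_image.mp h1
  obtain ⟨d, -, e⟩ := Finset.mem_image.mp h2
  exact xJ_ne_yJ c d e.symm

omit [Field K] in
/-- the `x`/`y`-choice `S ⊆ A` gives a pure support on `A`: `ptype (x(S) ∪ y(A ∖ S)) = 𝟙_A`. -/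
theorem ptype_choice {A S : Finset (Fin N)} (hS : S ⊆ A) : ptype (S.image (xJ N) ∪ (A \ S).image (yJ N)) = fun c => if c ∈ A then 1 else 0 := by
  rw [ptype_union (disjoint_image_xJ_image_yJ S (A \ S)), ptype_image_xJ, ptype_image_yJ]
  funext c
  simp only [Pi.add_apply, Finset.mem_sdiff]
  by_cases hcS : c ∈ S
  · rw [if_pos hcS, if_neg (fun h => h.2 hcS), if_pos (hS hcS)]
  · by_cases hcA : c ∈ A
    · rw [if_neg hcS, if_pos ⟨hcA, hcS⟩, if_pos hcA]
    · rw [if_neg hcS, if_neg (fun h => hcA h.1), if_neg hcA]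

omit [Field K] in
/-- `x_c` belongs to the choice support of `S ⊆ A` iff `c ∈ S`. -/
theorem xJ_mem_choice_iff {A S : Finset (Fin N)} (c : Fin N) : xJ N c ∈ S.image (xJ N) ∪ (A \ S).image (yJ N) ↔ c ∈ S := by
  rw [Finset.mem_union, Finset.mem_image, Finset.mem_image]
  constructor
  · rintro (⟨d, hd, e⟩ | ⟨d, -, e⟩)
    · exact xJ_injective e ▸ hd
    · exact absurd e.symm (xJ_ne_yJ c d)
  · exact fun h => Or.inl ⟨c, h, rfl⟩

omit [Field K] in
/-- **the pure supports on `A` are exactly the `x`/`y`-choices `S ⊆ A`; there are `2^{|A|}` of them.** -/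
theorem card_filter_ptype_eq_indicator (A : Finset (Fin N)) :
    (Finset.univ.filter fun s : Finset (In N) => ptype s = fun c => if c ∈ A then 1 else 0).card = 2 ^ A.card := by
  classical
  rw [← Finset.card_powerset]
  have himage : (Finset.univ.filter fun s : Finset (In N) => ptype s = fun c => if c ∈ A then 1 else 0)
      = A.powerset.image fun S => S.image (xJ N) ∪ (A \ S).image (yJ N) := by
    ext s
    simp only [Finset.mem_filter, Finset.mem_univ, true_and, Finset.mem_image, Finset.mem_powerset]
    constructor
    · intro hs
      refine ⟨A.filter fun c => xJ N c ∈ s, Finset.filter_subset _ _, ?_⟩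
      ext i
      rw [Finset.mem_union, Finset.mem_image, Finset.mem_image]
      constructor
      · rintro (⟨c, hc, rfl⟩ | ⟨c, hc, rfl⟩)
        · exact (Finset.mem_filter.mp hc).2
        · rw [Finset.mem_sdiff, Finset.mem_filter, not_and] at hc
          have h1 : ptype s c = 1 := by have := congr_fun hs c; rwa [if_pos hc.1] at this
          obtain ⟨j, hj⟩ := Finset.card_eq_one.mp h1
          have hj' : j ∈ s.filter fun i => pr i = c := by rw [hj]; exact Finset.mem_singleton_self j
          rw [Finset.mem_filter] at hj'
          rcases eq_xJ_or_eq_yJ j with e | e <;> rw [hj'.2] at e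
          · exact absurd (e ▸ hj'.1) (hc.2 hc.1)
          · exact e ▸ hj'.1
      · intro hi
        have hA : pr i ∈ A := mem_pairs_of_ptype_eq_indicator hs i hi
        rcases eq_xJ_or_eq_yJ i with e | e
        · exact Or.inl ⟨pr i, Finset.mem_filter.mpr ⟨hA, e ▸ hi⟩, e.symm⟩
        · refine Or.inr ⟨pr i, Finset.mem_sdiff.mpr ⟨hA, fun h => ?_⟩, e.symm⟩
          have hx := (Finset.mem_filter.mp h).2
          have h1 : ptype s (pr i) = 1 := by have := congr_fun hs (pr i); rwa [if_pos hA] at this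
          have h2 : 2 ≤ ptype s (pr i) := by
            rw [ptype]
            refine le_trans (by rw [Finset.card_pair (xJ_ne_yJ (pr i) (pr i))]) (Finset.card_le_card ?_)
            intro j hj
            rw [Finset.mem_insert, Finset.mem_singleton] at hj
            rw [Finset.mem_filter]
            rcases hj with rfl | rfl
            · exact ⟨hx, pr_xJ _⟩
            · exact ⟨e ▸ hi, pr_yJ _⟩
          omega
    · rintro ⟨S, hS, rfl⟩
      exact ptype_choice hS
  rw [himage, Finset.card_image_of_injOn]
  intro S hS S' hS' h
  rw [Finset.coe_powerset, Set.mem_preimage, Set.mem_powerset_iff, Finset.coe_subset] at hS hS'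
  ext c
  have h' := congr_arg (fun t : Finset (In N) => xJ N c ∈ t) h
  simp only [eq_iff_iff] at h'
  rw [xJ_mem_choice_iff, xJ_mem_choice_iff] at h'
  exact h'

/-- **THE COUNT: `dim Sp(ptype = 𝟙_A) = 2^{|A|}`.** -/
theorem finrank_Sp_pure (A : Finset (Fin N)) :
    finrank K ↥(Sp K (fun s : Finset (In N) => ptype s = fun c => if c ∈ A then 1 else 0)) = 2 ^ A.card := by
  classical
  rw [finrank_Sp, card_filter_ptype_eq_indicator]

/-- **THE PURE PIECES OF TH-7's KERNEL: `dim (Kr(univ, w_N q, |A|) ⊓ Sp(ptype = 𝟙_A)) + rank (hankel1 K N |A| q) = 2^{|A|}`** for every set `A` of pairs, every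
sequence `q` and every field. -/
theorem finrank_Kr_w_inf_Sp_pure_add (A : Finset (Fin N)) (q : ℕ → K) :
    finrank K ↥(Kr K (Finset.univ : Finset (In N)) (w K N N q) A.card ⊓ Sp K (fun s : Finset (In N) => ptype s = fun c => if c ∈ A then 1 else 0))
      + (hankel1 K N A.card q).rank = 2 ^ A.card := by
  rw [finrank_Kr_w_inf_Sp_pure_add_rank, finrank_Sp_pure]

/-- subtraction form: **`dim (Kr(univ, w_N q, |A|) ⊓ Sp(ptype = 𝟙_A)) = 2^{|A|} − rank (hankel1 K N |A| q)`.** -/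
theorem finrank_Kr_w_inf_Sp_pure_eq (A : Finset (Fin N)) (q : ℕ → K) :
    finrank K ↥(Kr K (Finset.univ : Finset (In N)) (w K N N q) A.card ⊓ Sp K (fun s : Finset (In N) => ptype s = fun c => if c ∈ A then 1 else 0))
      = 2 ^ A.card - (hankel1 K N A.card q).rank := by
  have h := finrank_Kr_w_inf_Sp_pure_add K A q
  omega

/-- **the NON-PURE `|A|`-forms on the letters of `A` have dimension `C(2|A|, |A|) − 2^{|A|}`** (and all of them lie in the kernel, `Sp_nonpure_le_Kr`). -/
theorem finrank_nonpure_eq (A : Finset (Fin N)) :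
    finrank K ↥(Hom K (In N) (Finset.univ : Finset (In N)) A.card ⊓ Sp K (fun s : Finset (In N) => ∀ i ∈ s, pr i ∈ A)
        ⊓ Sp K (fun s : Finset (In N) => ¬ ptype s = fun c => if c ∈ A then 1 else 0))
      = (A.card + A.card).choose A.card - 2 ^ A.card := by
  classical
  have h2 := finrank_inf_Sp_add_finrank_inf_Sp_not K (fun s : Finset (In N) => ptype s = fun c => if c ∈ A then 1 else 0)
    (W := Hom K (In N) (Finset.univ : Finset (In N)) A.card ⊓ Sp K (fun s : Finset (In N) => ∀ i ∈ s, pr i ∈ A))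
    (fun θ hθ => proj_ptype_mem_Hom_inf_Sp_pairs K _ A A.card hθ)
  rw [Hom_inf_Sp_pairs_inf_Sp_pure, finrank_Sp_pure] at h2
  conv_rhs => rw [← card_letters_eq, ← finrank_Hom_In K, ← Hom_univ_inf_Sp_pairs_eq, ← h2]
  omega

end Summit.Ventures.HSemireg.Wedge.HankelOuter
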